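import Mathlib
import HarnessLib
import Summits.HubbardSuperconductivity.HubbardSuperconductivity.Theorems.KLProgrammeKLRegimeTwoVolumeTowerStepCovZeroPlainSymbol

/-!
# K3 VL child `KLRegimeVolumeLimitV17F2` (stmt-HubbardSuperconductivity-20440), located item «SCALE-0-STEPCOV», part 2b (PLAIN `ℓ¹`, ALL TIMES): the ISOTROPIC
# moment-weighted `ℓ¹` norm of the plain slice kernel `(βV²)⁻²·Ψ̂_{(Λ₂,Λ₁]}[K]` at ONE admissible frame with `‖D³e_K‖ ≤ K₃` is `≤ C_b(K₃)·(M/β)`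

Cell `gate-hubbard-kl`, seat p3 (g17).  With part 1's reductions (`rowSumWt_klStepCov_zero_le'`, `colSumWt_klStepCov_zero_le`) this is the row / column half of
`ScaleCovData (klStepCov V M β μ K 0) …` at a frame whose band has a volume-free third derivative (the BASE frame `K_1` of the flow telescope, part 4):

* **`plainSlice_wt_l1_le (K₃)`** — `∃ C_b, s₁ > 0` (`s₁ ≤ 1`, explicit in `K₃` and the cutoff numerals) such that on any lattice `(V, M)`, at any frame with
  `FrameOK R U N μ K` and `‖D³e_K‖ ≤ K₃`, for `klBetaMin ≤ β ≤ M`: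
  `Σ_z (1 + s₁|z̃₂,₁| + s₁|z̃₂,₂|)·‖Σ_q χ_{q₁}(z₁)χ_{q₂}(z₂) • (βV²)⁻²Ψ̂_{(Λ₂,Λ₁]}(ω(q₁), e_K(q₂))‖ ≤ C_b·(M/β)`.
  Proof: p3's master lemma `sum_wt_norm_charSum_le_of_third_differences` with `v = e₂` (so `v⊥ = −e₁`; all four spatial directions are unit steps), near
  radius `R₀ = 0`, spatial rate `s₁ = 1/(2π(1 + Λ₂X))` (`X = X₂ + X₃(K₃)` of part 2a), time rate `s₀ = κ₀β/M`, `κ₀ = Λ₂/(2πD₃)`; the data are part 2a's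
  `plainSymbol_sup_le / _three_space_le / _three_time_le` and part 1's support count `card_support_sliceSymbolTorus_le`; the weight factor is
  `≤ √(M/β)·√C_W`, the Plancherel factor `≤ √(Mβ)·V²·√C_N`, the amplitude `4/(βV²Λ₂)`, and `√(M/β)·√(Mβ) = M`.

Everything is proved; no definitions, no sorry.  Nothing asserts any stub, K3, VL or superconductivity.
[cite: BenfattoGiulianiMastropietro2006, Lemma 2.2 (2.52), §2.7 (2.66)–(2.67), §2.8 (2.80)–(2.81)]
-/

noncomputable section

namespace Summit.HubbardSuperconductivity.HubbardSuperconductivity.Theorems.TorusFourierL2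

set_option linter.dupNamespace false -- summit = problem name (single-conjunct summit), D-0017

open Set Finset Literature.MathematicalPhysics.QuantumLattice Literature.MathematicalPhysics.QuantumLattice.BandSectorCounting
open Literature.MathematicalPhysics.QuantumLattice.FermiRG Literature.Probability.LatticeModels Literature.Analysis.SpecialFunctions
open Summit.HubbardSuperconductivity.HubbardSuperconductivity.Theorems.DispersionFlow
open Summit.HubbardSuperconductivity.HubbardSuperconductivity.Theorems.KLRegimeSplit
open Summit.HubbardSuperconductivity.HubbardSuperconductivity.Theorems.KLProgrammeLegKernels
open Summit.HubbardSuperconductivity.HubbardSuperconductivity.Theorems.PerturbedFermiCurve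
open Summit.HubbardSuperconductivity.HubbardSuperconductivity.Theorems.KLRegimeWick
open Summit.HubbardSuperconductivity.HubbardSuperconductivity.Theorems.TwoVolumeSource
open scoped Real Nat

open Classical

/-! ## §2 The all-times weighted `ℓ¹` norm at one admissible frame -/

section AllTimes

set_option maxHeartbeats 4000000 in -- explicit-constant bookkeeping against the large master lemma
/-- **THE ALL-TIMES ISOTROPIC WEIGHTED `ℓ¹` BOUND OF THE PLAIN SLICE KERNEL AT ONE ADMISSIBLE FRAME**: for every order-three size `K₃ ≥ 0` there are
`C_b, s₁ > 0` (`s₁ ≤ 1`) such that on any lattice, at any frame with `FrameOK R U N μ K` and `‖D³e_K‖ ≤ K₃`, for `klBetaMin ≤ β ≤ M`,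
`Σ_z (1 + s₁|z̃₂,₁| + s₁|z̃₂,₂|)·‖Σ_q χ_{q₁}(z₁)χ_{q₂}(z₂) • (βV²)⁻²Ψ̂_{(Λ₂,Λ₁]}(ω(q₁), e_K(q₂))‖ ≤ C_b·(M/β)`.
[cite: BenfattoGiulianiMastropietro2006, Lemma 2.2 (2.52), §2.8 (2.80)–(2.81)] -/
theorem plainSlice_wt_l1_le (K₃ : ℝ) (hK₃ : 0 ≤ K₃) :
    ∃ Cb s₁ : ℝ, 0 < Cb ∧ 0 < s₁ ∧ s₁ ≤ 1 ∧
      ∀ (V M : ℕ) [NeZero V] [NeZero M] (R : RenConsts) (U : ℝ) (N : ℕ) (μ : ℝ) (K : TrigPolyC4v), FrameOK R U N μ K →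
      (∀ p, ‖iteratedFDeriv ℝ 3 (frameLevel μ K) p‖ ≤ K₃) →
      ∀ β : ℝ, klBetaMin ≤ β → β ≤ (M : ℝ) →
        ∑ z : TorusSite 1 (2 * M) × TorusSite 2 V,
          (1 + s₁ * |(((z.2 0).valMinAbs : ℤ) : ℝ)| + s₁ * |(((z.2 1).valMinAbs : ℤ) : ℝ)|) *
            ‖∑ q : TorusSite 1 (2 * M) × TorusSite 2 V, (torusChar q.1 z.1 * torusChar q.2 z.2) •
              ((((1 / (β * (V : ℝ) ^ 2) : ℝ) : ℂ) ^ 2 *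
                sliceSymbolFnXi (β * (V : ℝ) ^ 2) 0 (klScale klE0 2) (klScale klE0 1) (matsubaraFreq β M ⟨(q.1 0).val, ZMod.val_lt (q.1 0)⟩)
                  (nambuXiCT V μ K q.2)))‖ ≤ Cb * ((M : ℝ) / β) := by
  -- the cutoff numerals and the slice constants
  set D₁ : ℝ := 16 * (32 / 3 : ℝ) + 16 with hD₁
  set D₂ : ℝ := 32 * (448 / 3 * Real.exp 2) + 144 * (32 / 3 : ℝ) + 128 with hD₂
  set D₃ : ℝ := 64 * (44900 : ℝ) + 480 * (448 / 3 * Real.exp 2) + 1728 * (32 / 3 : ℝ) + 1536 with hD₃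
  have hD₁0 : 0 < D₁ := by rw [hD₁]; norm_num
  have hD₂0 : 0 < D₂ := by rw [hD₂]; positivity
  have hD₃0 : 0 < D₃ := by rw [hD₃]; positivity
  have hD₃1 : 1 ≤ D₃ := by rw [hD₃]; have := Real.exp_pos 2; nlinarith
  have he : (0 : ℝ) < klE0 := by norm_num [klE0]
  set Λ₂ : ℝ := klScale klE0 2 with hΛ₂def
  set Λ₁ : ℝ := klScale klE0 1 with hΛ₁def
  have hΛ2 : 0 < Λ₂ := klth_klScale_pos 2
  have hΛ1 : 0 < Λ₁ := klth_klScale_pos 1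
  have hΛ21 : Λ₂ ≤ Λ₁ := EngineV8.klScale_le_klScale he.le (by norm_num)
  have hΛ1t : Λ₁ < 3 / 80 := klScale_klE0_lt_tube 1
  have hπ := Real.pi_pos
  -- the spatial polynomials and the spatial rate
  set X₂ : ℝ := D₂ * (7 + 28 * π) ^ 2 / Λ₂ ^ 3 + 7 * D₁ / Λ₂ ^ 2 with hX₂
  set X₃ : ℝ := D₃ * (7 + 42 * π) ^ 3 / Λ₂ ^ 4 + 21 * D₂ * (7 + 42 * π) / Λ₂ ^ 3 + D₁ * K₃ / Λ₂ ^ 2 with hX₃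
  set X : ℝ := X₂ + X₃ with hX
  have hX₂0 : 0 ≤ X₂ := by rw [hX₂]; positivity
  have hX₃0 : 0 ≤ X₃ := by rw [hX₃]; positivity
  have hX0 : 0 ≤ X := by rw [hX]; positivity
  set s₁ : ℝ := 1 / (2 * π * (1 + Λ₂ * X)) with hs₁
  have hs₁0 : 0 < s₁ := by rw [hs₁]; positivity
  have hs₁1 : s₁ ≤ 1 := by
    rw [hs₁, div_le_one (by positivity)]
    have : 0 ≤ Λ₂ * X := by positivity
    nlinarith [Real.pi_gt_three]
  -- the time-rate constant and the final constant
  set κ₀ : ℝ := Λ₂ / (2 * π * D₃) with hκ₀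
  have hκ₀0 : 0 < κ₀ := by rw [hκ₀]; positivity
  set CW : ℝ := 32768 * (1 / κ₀ + 1) *
      ((1 + 4 * Real.sqrt 2) ^ 2 * (4 * ((2 * Real.sqrt 2 / s₁ + 2) * (2 * Real.sqrt 2 / s₁ + 2))) + 16 * (1 / s₁ + 1) ^ 2) with hCW
  set CN : ℝ := 42 * (Λ₁ / π + 3 / 128) * (1793 * Λ₁ + 704) with hCN
  have hCW0 : 0 < CW := by rw [hCW]; positivity
  have hCN0 : 0 < CN := by rw [hCN]; positivity
  refine ⟨Real.sqrt CW * Real.sqrt CN * (4 / Λ₂), s₁, by positivity, hs₁0, hs₁1, ?_⟩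
  intro V M _ _ R U N μ K hK hK3 β hβmin hβM
  -- the instance
  have hβ0 : 0 < β := pos_of_klBetaMin_le hβmin
  have hβ128 : (128 : ℝ) ≤ β := by simpa [klBetaMin] using hβmin
  have hV1 : (1 : ℝ) ≤ V := by exact_mod_cast Nat.pos_of_ne_zero (NeZero.ne V)
  have hV0 : (0 : ℝ) < V := by linarith
  have hM0 : (0 : ℝ) < M := lt_of_lt_of_le hβ0 hβM
  have hMβ : 1 ≤ (M : ℝ) / β := by rw [le_div_iff₀ hβ0, one_mul]; exact hβM
  have hc : 0 < β * (V : ℝ) ^ 2 := by positivity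
  obtain ⟨hre, hrn, hrv, hv⟩ := unitDirs_sq
  -- abbreviations
  set c₀ : ℂ := (((1 / (β * (V : ℝ) ^ 2) : ℝ) : ℂ)) ^ 2 with hc₀def
  set Ψ : TorusSite 1 (2 * M) × TorusSite 2 V → ℂ := fun q =>
    sliceSymbolFnXi (β * (V : ℝ) ^ 2) 0 Λ₂ Λ₁ (matsubaraFreq β M ⟨(q.1 0).val, ZMod.val_lt (q.1 0)⟩) (nambuXiCT V μ K q.2) with hΨdef
  set A₀ : ℝ := (1 / (β * (V : ℝ) ^ 2)) ^ 2 * (4 * (β * (V : ℝ) ^ 2) / Λ₂) with hA₀def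
  have hA₀0 : 0 ≤ A₀ := by positivity
  have hA₀eq : A₀ = 4 / (β * (V : ℝ) ^ 2 * Λ₂) := by rw [hA₀def]; field_simp
  set s₀ : ℝ := κ₀ * β / M with hs₀def
  have hs₀0 : 0 < s₀ := by positivity
  -- (a) sup
  have hsup : ∀ q, ‖c₀ * Ψ q‖ ≤ A₀ := fun q => plainSymbol_sup_le (V := V) (M := M) hβ0 μ K q
  -- (b) rate identities
  have key3 : X₃ ≤ 256 * (1 + Λ₂ * X) ^ 3 / Λ₂ := by
    rw [le_div_iff₀ hΛ2]
    have h0 : 0 ≤ Λ₂ * X₂ := mul_nonneg hΛ2.le hX₂0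
    have h1 : X₃ * Λ₂ ≤ 1 + Λ₂ * X := by rw [hX, mul_add]; linarith [mul_comm X₃ Λ₂]
    have h2 : (1 : ℝ) ≤ 1 + Λ₂ * X := by linarith [mul_nonneg hΛ2.le hX0]
    have h3 : 1 + Λ₂ * X ≤ (1 + Λ₂ * X) ^ 3 := le_self_pow₀ h2 (by norm_num)
    have h4 : 0 ≤ (1 + Λ₂ * X) ^ 3 := by positivity
    linarith
  have hsV3 : (4 / (s₁ * V)) ^ 3 = (2 * π / V) ^ 3 * (64 * (1 + Λ₂ * X) ^ 3) := by
    rw [hs₁]; field_simp; ring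
  -- (c) the three spatial third-difference inputs and the time input
  have hspace3 : ∀ r : Fin 2 → ℤ, (r 0 : ℝ) ^ 2 + (r 1 : ℝ) ^ 2 = 1 → ∀ q,
      ‖((fwdDiff ((0 : TorusSite 1 (2 * M)), (fun i => ((r i : ℤ) : ZMod V))))^[3] (fun y => c₀ * Ψ y)) q‖ ≤ A₀ * (4 / (s₁ * V)) ^ 3 := by
    intro r hr q
    refine (plainSymbol_three_space_le (V := V) (M := M) hK hβ0 hK3 r hr q).trans ?_
    conv_rhs => rw [hA₀def, mul_assoc]
    refine mul_le_mul_of_nonneg_left ?_ (by positivity)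
    rw [← hD₃, ← hD₂, ← hD₁, ← hΛ₂def, ← hX₃, hsV3]
    have : β * (V : ℝ) ^ 2 * (2 * π / V) ^ 3 * X₃ ≤ β * (V : ℝ) ^ 2 * (2 * π / V) ^ 3 * (256 * (1 + Λ₂ * X) ^ 3 / Λ₂) :=
      mul_le_mul_of_nonneg_left key3 (by positivity)
    refine this.trans (le_of_eq ?_)
    field_simp
    ring
  have htime : ∀ q, ‖((fwdDiff ((fun _ : Fin 1 => (1 : ZMod (2 * M))), (0 : TorusSite 2 V)))^[3] (fun y => c₀ * Ψ y)) q‖ ≤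
      A₀ * (4 / (s₀ * ((2 * M : ℕ) : ℝ))) ^ 3 := by
    intro q
    refine (plainSymbol_three_time_le (V := V) (M := M) hβmin hβM μ K q).trans ?_
    conv_rhs => rw [hA₀def, mul_assoc]
    rw [← hD₃]
    refine mul_le_mul_of_nonneg_left ?_ (by positivity)
    have e4 : 4 / (s₀ * ((2 * M : ℕ) : ℝ)) = 4 * π * D₃ / (Λ₂ * β) := by
      rw [hs₀def, hκ₀]; push_cast; field_simp
    rw [e4]
    have lhs : (2 * π / β) ^ 3 * (D₃ * (β * (V : ℝ) ^ 2) / Λ₂ ^ 4) = π ^ 3 * (β * (V : ℝ) ^ 2) / (β ^ 3 * Λ₂ ^ 4) * (8 * D₃) := by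
      field_simp; ring
    have rhs : 4 * (β * (V : ℝ) ^ 2) / Λ₂ * (4 * π * D₃ / (Λ₂ * β)) ^ 3 = π ^ 3 * (β * (V : ℝ) ^ 2) / (β ^ 3 * Λ₂ ^ 4) * (256 * D₃ ^ 3) := by
      field_simp; ring
    rw [lhs, rhs]
    refine mul_le_mul_of_nonneg_left ?_ (by positivity)
    have hD33 : D₃ ≤ D₃ ^ 3 := le_self_pow₀ hD₃1 (by norm_num)
    have hD30 : 0 ≤ D₃ ^ 3 := by positivity
    linarith
  -- (d) the support count
  have hsuppΨ := card_support_sliceSymbolTorus_le (V := V) (M := M) hK hβ0 (β * (V : ℝ) ^ 2) hΛ2 hΛ21 hΛ1t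
  have hsub : ((univ : Finset (TorusSite 1 (2 * M) × TorusSite 2 V)).filter fun q => c₀ * Ψ q ≠ 0) ⊆
      (univ : Finset (TorusSite 1 (2 * M) × TorusSite 2 V)).filter fun q =>
        sliceSymbolFnXi (β * (V : ℝ) ^ 2) 0 Λ₂ Λ₁ (matsubaraFreq β M ⟨(q.1 0).val, ZMod.val_lt (q.1 0)⟩) (nambuXiCT V μ K q.2) ≠ 0 := by
    intro q hq
    rw [mem_filter] at hq ⊢
    exact ⟨hq.1, fun h => hq.2 (by simp only [hΨdef]; rw [h, mul_zero])⟩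
  have hNs : ((((univ : Finset (TorusSite 1 (2 * M) × TorusSite 2 V)).filter fun q => c₀ * Ψ q ≠ 0).card : ℕ) : ℝ) ≤
      β * (V : ℝ) ^ 2 * ((Λ₁ / π + 3 / 128) * (1793 * Λ₁ + 704)) := by
    refine le_trans (Nat.cast_le.2 (Finset.card_le_card hsub)) (hsuppΨ.trans ?_)
    have h1 : Λ₁ * β / π + 3 ≤ β * (Λ₁ / π + 3 / 128) := by
      rw [mul_add]
      have : (3 : ℝ) ≤ β * (3 / 128) := by linarith
      have e : Λ₁ * β / π = β * (Λ₁ / π) := by ring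
      linarith
    have hVV : (V : ℝ) ≤ (V : ℝ) ^ 2 := le_self_pow₀ hV1 (by norm_num)
    have h2 : 1793 * Λ₁ * (V : ℝ) ^ 2 + 704 * V ≤ (V : ℝ) ^ 2 * (1793 * Λ₁ + 704) := by
      have e : (V : ℝ) ^ 2 * (1793 * Λ₁ + 704) = 1793 * Λ₁ * (V : ℝ) ^ 2 + 704 * (V : ℝ) ^ 2 := by ring
      rw [e]; linarith
    calc (Λ₁ * β / π + 3) * (1793 * Λ₁ * (V : ℝ) ^ 2 + 704 * V) ≤ (β * (Λ₁ / π + 3 / 128)) * ((V : ℝ) ^ 2 * (1793 * Λ₁ + 704)) :=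
          mul_le_mul h1 h2 (by positivity) (by positivity)
      _ = _ := by ring
  -- (e) the master lemma, then drop the time moment and evaluate the constant
  have main := sum_wt_norm_charSum_le_of_third_differences (fun q => c₀ * Ψ q) (![0, 1] : Fin 2 → ℤ) hv hs₀0 hs₁0 hs₁0 hs₁0 (R₀ := 0)
    (by push_cast; rw [mul_zero]; exact_mod_cast Nat.pos_of_ne_zero (NeZero.ne V)) hA₀0 le_rfl hsup htime
    (fun q i => by rw [pi_single_zmod_eq_intCast V i]; exact hspace3 _ (hre i) q) (fun q => hspace3 _ hrn q) (fun q => hspace3 _ hrv q)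
  refine le_trans (Finset.sum_le_sum fun z _ => mul_le_mul_of_nonneg_right ?_ (norm_nonneg _)) (main.trans ?_)
  · have : 0 ≤ s₀ * |(((z.1 0).valMinAbs : ℤ) : ℝ)| := by positivity
    linarith
  have hv0 : (((![0, 1] : Fin 2 → ℤ) 0 : ℤ) : ℝ) = 0 := by simp
  have hv1 : (((![0, 1] : Fin 2 → ℤ) 1 : ℤ) : ℝ) = 1 := by simp
  rw [hv0, hv1]
  have hsq1 : Real.sqrt ((0 : ℝ) ^ 2 + (1 : ℝ) ^ 2) = 1 := by norm_num
  rw [hsq1]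
  have es : 2 * Real.sqrt 2 * s₁ / (s₁ * 1) = 2 * Real.sqrt 2 := by field_simp
  rw [es, Nat.cast_zero, mul_zero, add_zero, div_one, mul_one]
  have e2 : (1 + 2 * Real.sqrt 2 + 2 * Real.sqrt 2) = 1 + 4 * Real.sqrt 2 := by ring
  rw [e2]
  have hW : 32768 * (1 / s₀ + 1) * ((1 + 4 * Real.sqrt 2) ^ 2 *
      (4 * ((2 * Real.sqrt 2 / s₁ + 2) * (2 * Real.sqrt 2 / s₁ + 2))) + 16 * (1 / s₁ + 1) ^ 2) ≤ (M : ℝ) / β * CW := by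
    rw [hCW]
    have h1 : 1 / s₀ + 1 ≤ (M : ℝ) / β * (1 / κ₀ + 1) := by
      rw [hs₀def]
      have e : 1 / (κ₀ * β / (M : ℝ)) = (M : ℝ) / β * (1 / κ₀) := by field_simp
      rw [e]; linarith
    have hpos : 0 ≤ (1 + 4 * Real.sqrt 2) ^ 2 * (4 * ((2 * Real.sqrt 2 / s₁ + 2) * (2 * Real.sqrt 2 / s₁ + 2))) + 16 * (1 / s₁ + 1) ^ 2 := by
      positivity
    calc 32768 * (1 / s₀ + 1) * ((1 + 4 * Real.sqrt 2) ^ 2 * (4 * ((2 * Real.sqrt 2 / s₁ + 2) * (2 * Real.sqrt 2 / s₁ + 2))) + 16 * (1 / s₁ + 1) ^ 2)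
        ≤ 32768 * ((M : ℝ) / β * (1 / κ₀ + 1)) *
          ((1 + 4 * Real.sqrt 2) ^ 2 * (4 * ((2 * Real.sqrt 2 / s₁ + 2) * (2 * Real.sqrt 2 / s₁ + 2))) + 16 * (1 / s₁ + 1) ^ 2) := by
          gcongr
      _ = _ := by ring
  have hN : 21 * ((2 * M : ℕ) : ℝ) * (V : ℝ) ^ 2 * ((((univ : Finset (TorusSite 1 (2 * M) × TorusSite 2 V)).filter fun q => c₀ * Ψ q ≠ 0).card : ℕ) : ℝ) ≤
      (M : ℝ) * β * (V : ℝ) ^ 4 * CN := by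
    rw [hCN]; push_cast
    calc 21 * (2 * (M : ℝ)) * (V : ℝ) ^ 2 * ((((univ : Finset (TorusSite 1 (2 * M) × TorusSite 2 V)).filter fun q => c₀ * Ψ q ≠ 0).card : ℕ) : ℝ)
        ≤ 21 * (2 * (M : ℝ)) * (V : ℝ) ^ 2 * (β * (V : ℝ) ^ 2 * ((Λ₁ / π + 3 / 128) * (1793 * Λ₁ + 704))) :=
          mul_le_mul_of_nonneg_left hNs (by positivity)
      _ = _ := by ring
  have hWs : Real.sqrt (32768 * (1 / s₀ + 1) * ((1 + 4 * Real.sqrt 2) ^ 2 *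
      (4 * ((2 * Real.sqrt 2 / s₁ + 2) * (2 * Real.sqrt 2 / s₁ + 2))) + 16 * (1 / s₁ + 1) ^ 2)) ≤ Real.sqrt ((M : ℝ) / β) * Real.sqrt CW := by
    rw [← Real.sqrt_mul (by positivity)]; exact Real.sqrt_le_sqrt hW
  have hNsq : Real.sqrt (21 * ((2 * M : ℕ) : ℝ) * (V : ℝ) ^ 2 * ((((univ : Finset (TorusSite 1 (2 * M) × TorusSite 2 V)).filter fun q => c₀ * Ψ q ≠ 0).card : ℕ) : ℝ)) ≤
      Real.sqrt ((M : ℝ) * β) * (V : ℝ) ^ 2 * Real.sqrt CN := by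
    have e : Real.sqrt ((M : ℝ) * β * (V : ℝ) ^ 4 * CN) = Real.sqrt ((M : ℝ) * β) * (V : ℝ) ^ 2 * Real.sqrt CN := by
      rw [show (M : ℝ) * β * (V : ℝ) ^ 4 * CN = ((M : ℝ) * β) * (((V : ℝ) ^ 2) ^ 2) * CN by ring,
        Real.sqrt_mul (by positivity) CN, Real.sqrt_mul (by positivity) (((V : ℝ) ^ 2) ^ 2), Real.sqrt_sq (by positivity)]
    rw [← e]; exact Real.sqrt_le_sqrt hN
  have hMM : Real.sqrt ((M : ℝ) / β) * Real.sqrt ((M : ℝ) * β) = M := by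
    rw [← Real.sqrt_mul (by positivity), show (M : ℝ) / β * ((M : ℝ) * β) = (M : ℝ) * M by field_simp, Real.sqrt_mul_self hM0.le]
  calc Real.sqrt (32768 * (1 / s₀ + 1) * ((1 + 4 * Real.sqrt 2) ^ 2 *
        (4 * ((2 * Real.sqrt 2 / s₁ + 2) * (2 * Real.sqrt 2 / s₁ + 2))) + 16 * (1 / s₁ + 1) ^ 2)) *
        Real.sqrt (21 * ((2 * M : ℕ) : ℝ) * (V : ℝ) ^ 2 * ((((univ : Finset (TorusSite 1 (2 * M) × TorusSite 2 V)).filter fun q => c₀ * Ψ q ≠ 0).card : ℕ) : ℝ)) * A₀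
      ≤ (Real.sqrt ((M : ℝ) / β) * Real.sqrt CW) * (Real.sqrt ((M : ℝ) * β) * (V : ℝ) ^ 2 * Real.sqrt CN) * A₀ := by gcongr
    _ = Real.sqrt CW * Real.sqrt CN * (4 / Λ₂) * ((Real.sqrt ((M : ℝ) / β) * Real.sqrt ((M : ℝ) * β)) / β) := by
        rw [hA₀eq]; field_simp
    _ = Real.sqrt CW * Real.sqrt CN * (4 / Λ₂) * ((M : ℝ) / β) := by rw [hMM]

end AllTimes

end Summit.HubbardSuperconductivity.HubbardSuperconductivity.Theorems.TorusFourierL2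

end
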